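import Literature.AlgebraicGeometry.Motives.GaloisDescentScheme
import Literature.AlgebraicGeometry.Motives.ProjectiveDescentNormProofs
import Literature.AlgebraicGeometry.RelativeSpec.SymmetricPowerGlued
import Mathlib.AlgebraicGeometry.ProjectiveSpectrum.Proper
import HarnessLib

/-!
# Stable affine opens cover a projective scheme with a finite group action over an AFFINE base
# (SGA 1 V 1.8; Mumford AV §7 Thm. p. 66, hypothesis — proofs only)

Topic `Literature/AlgebraicGeometry/RelativeSpec`; namespace `Literature.AlgebraicGeometry.RelativeSpec`. THEOREMS ONLY (no
definition, no named fact, no instance, no notation, no `sorry`). Cell `hodgecm-mathlib`, P6 «MOD programme», LEAD F0P6-plan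
ruling M-1 (F)∕M-1a (5) HAND M-A: the letter `_hcov` of PWCORE ∕ `RecordTameLevelQuotientModel`
(`∀ x : X.left, ∃ O : ρ.StableAffineOpens, x ∈ O.1`) for the integral model `𝒮c → Spec 𝒪_{F,(w)}` with its finite `K∕Kc`-action.

Let `Y` be an AFFINE scheme (e.g. `Spec R`), `f : X ⟶ Y`, and suppose `X` admits a closed immersion `r : X ↪ Proj A` into the `Proj`
of a graded ring (e.g. `X` a closed subscheme of `ℙⁿ_R = Proj R[x₀,…,xₙ]`; no compatibility of `r` with `f` is needed). Then:

* `finiteSubsetsInAffineOpens_of_isClosedImmersion_proj` — **every finite set of points of `X` lies in an affine open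
  `X ∩ D₊(F)`, `F` homogeneous of positive degree** (graded prime avoidance, ★ `GradedPrimeAvoidance.exists_form_basicOpen`;
  `D₊(F)` is affine, Mathlib `Proj.isAffineOpen_basicOpen`), affine over the affine `Y` — the tree's
  `FiniteSubsetsInAffineOpens f` (field case ★ `IsProjectiveOver.finiteSubsetsInAffineOpens`, same proof);
  `exists_isAffineOpen_finset_subset` — the same in the currency `∃ U : X.Opens, IsAffineOpen U ∧ ↑S ⊆ U`;
* (private) such an `X` is separated (Mathlib: `Proj A` is separated);
* **`forall_exists_stableAffineOpen_of_isClosedImmersion_proj`** — for a finite group `G` acting on `X` over `Y`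
  (★ `ActionOver f G`), **every point of `X` lies in a `G`-stable open which is affine over `Y`**:
  `∀ x : X, ∃ O : ρ.StableAffineOpens, x ∈ O.1` (intersect an affine open containing the orbit over the orbit — ★
  `GaloisDescentScheme.forall_exists_stableAffineOpen`, which is stated for any affine base); and the `Over`-category spelling
  `forall_exists_stableAffineOpen_over` for `X : Over Y`, `ρ : ActionOver X.hom G` (= the `_hcov` letter verbatim).

## References
* [SGA1] A. Grothendieck, SGA 1, Exp. V, Prop. 1.8 («si `X` est quasi-projectif sur `Y` affine, toute partie finie de `X` est
  contenue dans un ouvert affine … invariant par `G`»).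
* [MumfordAV1970] D. Mumford, *Abelian Varieties* (1970), §7, Theorem p. 66 (hypothesis) and Remark p. 69.
* [Singh2011] B. Singh, *Basic Commutative Algebra* (2011), 2.9.2 (graded prime avoidance).
-/

noncomputable section

universe u

open CategoryTheory Limits AlgebraicGeometry

namespace Literature.AlgebraicGeometry.RelativeSpec

open Literature.AlgebraicGeometry.Motives

variable {X Y : Scheme.{u}} (f : X ⟶ Y) {A σ : Type u} [CommRing A] [SetLike σ A] [AddSubgroupClass σ A]
  (𝒜 : ℕ → σ) [GradedRing 𝒜] (r : X ⟶ Proj 𝒜) [IsClosedImmersion r]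

/-! ## §1 Finite subsets of a closed subscheme of `Proj A` lie in affine opens -/

include r in
/-- **Finite subsets of a closed subscheme of `Proj A` lie in basic affine opens `X ∩ D₊(F)`** (graded prime avoidance:
a form `F` of positive degree not vanishing at finitely many given points; `D₊(F)` is affine and closed immersions are
affine). Currency `IsAffineOpen`. [cite: SGA1, Exp. V, Prop. 1.8] [cite: Singh2011, 2.9.2 (p. 39)] -/
theorem exists_isAffineOpen_finset_subset (S : Finset X) :
    ∃ U : X.Opens, IsAffineOpen U ∧ (↑S : Set X) ⊆ U := by
  classical
  obtain ⟨m, F, hm, hF, hS, -⟩ := GradedPrimeAvoidance.exists_form_basicOpen 𝒜 r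
    r.isClosedEmbedding.injective r.isClosedEmbedding.isClosedMap S ⊤ (fun _ _ => trivial)
  exact ⟨r ⁻¹ᵁ Proj.basicOpen 𝒜 F, (Proj.isAffineOpen_basicOpen 𝒜 F hF hm).preimage r, fun x hx => hS x hx⟩

include r in
/-- The same in the tree's currency `FiniteSubsetsInAffineOpens f` («every finite set of points lies in an open affine over the
base»), for `Y` affine — the ring-base analogue of ★ `IsProjectiveOver.finiteSubsetsInAffineOpens`.
[cite: SGA1, Exp. V, Prop. 1.8] [cite: MumfordAV1970, §7 Remark p. 69] -/
theorem finiteSubsetsInAffineOpens_of_isClosedImmersion_proj [IsAffine Y] : FiniteSubsetsInAffineOpens f := by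
  refine ⟨fun T => ?_⟩
  obtain ⟨U, hU, hT⟩ := exists_isAffineOpen_finset_subset 𝒜 r T
  haveI : IsAffine (U : Scheme.{u}) := hU
  exact ⟨U, inferInstance, fun t ht => hT (Finset.mem_coe.mpr ht)⟩

include r in
/-- A scheme with a closed immersion into `Proj A` is separated (Mathlib: `Proj A` is separated; closed immersions are
separated). [folklore] -/
private theorem isSeparated_of_isClosedImmersion_proj : X.IsSeparated :=
  ⟨by rw [← terminal.comp_from r]; infer_instance⟩

/-! ## §2 Every point lies in a `G`-stable open, affine over the affine base -/

variable {f} {G : Type*} [Group G] [Finite G] (ρ : ActionOver f G)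

include r in
/-- **Every point of a scheme projective over an AFFINE base, with a finite group acting over the base, lies in a `G`-stable
open affine over the base** (SGA 1 V 1.8: for `X` quasi-projective over affine `Y`, every finite subset — here the orbit
`G·x` — lies in an affine open, and `⋂_g g·U` is then a `G`-stable affine open; Mumford AV §7 Thm. p. 66, the hypothesis
«the orbit of any point is contained in an affine open subset»). Over ★ `GaloisDescentScheme.forall_exists_stableAffineOpen`.
[cite: SGA1, Exp. V, Prop. 1.8] [cite: MumfordAV1970, §7 Thm. p. 66 (hypothesis)] -/
theorem forall_exists_stableAffineOpen_of_isClosedImmersion_proj [IsAffine Y] (x : X) :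
    ∃ O : ρ.StableAffineOpens, x ∈ O.1 := by
  haveI : X.IsSeparated := isSeparated_of_isClosedImmersion_proj 𝒜 r
  exact GaloisDescentScheme.forall_exists_stableAffineOpen ρ (exists_isAffineOpen_finset_subset 𝒜 r) x

/-- **The `_hcov` letter, `Over`-category spelling**: for `X : Over Y` with `Y` affine (e.g. `Y = Spec 𝒪`), a closed immersion
`X.left ↪ Proj A` (e.g. `X` projective over `𝒪`) and a finite group `G` acting on `X` over `Y` (`ρ : ActionOver X.hom G`):
`∀ x : X.left, ∃ O : ρ.StableAffineOpens, x ∈ O.1`. [cite: SGA1, Exp. V, Prop. 1.8] -/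
theorem forall_exists_stableAffineOpen_over {Y : Scheme.{u}} [IsAffine Y] (X : Over Y)
    (r : X.left ⟶ Proj 𝒜) [IsClosedImmersion r] {G : Type*} [Group G] [Finite G] (ρ : ActionOver X.hom G) :
    ∀ x : X.left, ∃ O : ρ.StableAffineOpens, x ∈ O.1 :=
  forall_exists_stableAffineOpen_of_isClosedImmersion_proj 𝒜 r ρ

end Literature.AlgebraicGeometry.RelativeSpec
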